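import Mathlib
import Literature.NumberTheory.LFunctions.Zhang2022.SkeletonPartOne
import Literature.NumberTheory.LFunctions.Zhang2022.SkeletonAssembly
import HarnessLib

/-!
# Zhang (2022) §2, proof of Lemma 2.3 (pp. 11–12), I: the inputs — consecutive zeros under the
# gap assertion, finiteness of the `Ω`-zeros, and `M(½+it,ψ)` as a real continuous function

Topic `Literature/NumberTheory/LFunctions/Zhang2022` (Landau–Siegel adjudication tree;
verdict-neutral). Y. Zhang, *Discrete mean estimates and the Landau–Siegel zero*,
arXiv:2211.02515v1 (2022) [Zhang2022LandauSiegel] — an unrefereed manuscript under adjudication.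
DAG node `Z22:Lem2.3.pf` [Z22 p.11, tex L667–L685], steps `Z22:§2.u035`–`§2.u036`:

> *Proof of Lemma 2.3.* By (2.) [the restated gap assertion (iii) of Proposition 2.2, p. 7]
> we see that `M(ρ+iv,ψ) ≠ 0` if `|β₂| ≤ v ≤ |β₃|`. This implies, by the mean-value theorem, that
> `M(ρ+β₂,ψ)M(ρ+β₃,ψ) > 0`, since `M(1/2+it,ψ)` is a real-valued continuous function in `t`.
> Similarly we have `M(ρ+β₁,ψ)/M(ρ+iv,ψ) > 0` if `0 < v ≤ |β₁|`. […]

(`ψ ∈ Ψ₁`, `ρ = ½+iγ ∈ 𝔷(ψ)` (2.14), `M = Y·L(·,ψ)` with `Y² = Z(·,ψ)⁻¹` (§2 p. 5),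
`β₁ = iα(1−5c′α𝓛)`, `β₂ = 2iα(1+c′α𝓛)`, `β₃ = 3iα(1−c′α𝓛)` (2.13).) This file PROVES the
ingredients of these two sentences for the skeleton's real objects (`Skeleton.Mfun`, `Skeleton.Yroot`,
`Skeleton.prodZeroSetOmega`, `Skeleton.zeroSet`), with no hypothesis beyond what is displayed:

* `mul_pos_of_continuousOn_of_ne_zero`, `mul_pos_of_hasDerivAt_of_ne_zero` — the two real-variable
  sign lemmas behind "by the mean-value theorem" (an intermediate-value argument) and behind the
  limit "`lim_{v→0⁺} vM(ρ+β₁)/M(ρ+iv)`" of p. 12 (a right-hand slope);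
* `exists_next_above_gap`, `im_gt_of_gap`, `im_gt_of_gap_three` — where the restated gap assertion
  "`|γ′ − γ − α| < c′α²𝓛` for consecutive zeros" (p. 7) puts the zeros above a zero at height `γ`:
  none in `(γ, γ + α − c′α²𝓛]`, none in `[γ + 2α + 2c′α²𝓛, γ + 3α − 3c′α²𝓛]` (for a FINITE zero set;
  "consecutive" = next one up);
* `prodZeroSetOmega_finite` — the zeros of `L(s,ψ)L(s,ψχ)` in `Ω` form a finite set (identity
  principle; `L(2,ψ)L(2,ψχ) ≠ 0`), for `D ≥ 3`, `χ` primitive;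
* `Mfun_half_im_eq_zero`, `continuousOn_Mfun_half_re`, `hasDerivAt_Mfun_half_re`, `Mfun_ne_zero` —
  "`M(1/2+it,ψ)` is a real-valued continuous function in `t`" ((2.11)), its derivative `iM′` is real
  ((2.12)) (tree `GammaFactor.M_half_im_eq_zero`, `I_mul_deriv_M_half_im_eq_zero`), and `M ≠ 0`
  where `L ≠ 0`;
* `LFunction_half_ne_zero_of_gap` — the two displayed non-vanishing ranges for `L(½+iu,ψ)`;
  `deriv_LFunction_ne_zero_of_deriv_LL_ne_zero` — simplicity (ii) gives `L′(ρ,ψ) ≠ 0`.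

The companion file `Section2Lemma23Holds.lean` assembles them into `Skeleton.ded23_holds :
0 ≤ c′ → Ded23 c′` (Proposition 2.2 ⇒ Lemma 2.3). No new definitions, no named facts; nothing here
bears on Theorems 1–2 of the source or on the cell's verdict on (8.24). Cell siegel-zhang (D-0069),
discharge row D20 / cone C11.

## References

* Y. Zhang, arXiv:2211.02515v1 (2022), §2: Proposition 2.2 and its restatement (2.13) p. 7,
  (2.11)–(2.12), (2.14), proof of Lemma 2.3 pp. 11–12 (tex L667–L685).
  [cite: Zhang2022LandauSiegel, §2 Lemma 2.3 (proof) pp. 11–12]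
-/

noncomputable section

open Complex Real Filter Topology Set

namespace Literature.NumberTheory.LFunctions.Zhang2022.Skeleton


/-! ## Two real-variable sign lemmas ("by the mean-value theorem", "`lim_{v→0⁺}`") -/

/-- A continuous real function without zeros on `[a, b]` has the same (strict) sign at the two
end-points: `f(a)f(b) > 0` (intermediate value theorem; the manuscript's "by the mean-value
theorem … since `M(1/2+it,ψ)` is a real-valued continuous function in `t`", p. 11).
[cite: Zhang2022LandauSiegel, §2 proof of Lemma 2.3 p. 11] -/
theorem mul_pos_of_continuousOn_of_ne_zero {f : ℝ → ℝ} {a b : ℝ} (hab : a ≤ b)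
    (hf : ContinuousOn f (Icc a b)) (hne : ∀ u ∈ Icc a b, f u ≠ 0) : 0 < f a * f b := by
  have ha : f a ≠ 0 := hne a (left_mem_Icc.mpr hab)
  have hb : f b ≠ 0 := hne b (right_mem_Icc.mpr hab)
  by_contra hle
  push Not at hle
  rcases lt_or_gt_of_ne ha with ha' | ha'
  · -- `f a < 0`, hence `f b > 0`, and `0 ∈ [f a, f b]`
    have hb' : 0 < f b := by
      rcases lt_or_gt_of_ne hb with h | h
      · exact absurd hle (not_le.mpr (mul_pos_of_neg_of_neg ha' h))
      · exact h
    obtain ⟨c, hc, hfc⟩ := intermediate_value_Icc hab hf ⟨ha'.le, hb'.le⟩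
    exact hne c hc hfc
  · -- `f a > 0`, hence `f b < 0`, and `0 ∈ [f b, f a]`
    have hb' : f b < 0 := by
      rcases lt_or_gt_of_ne hb with h | h
      · exact h
      · exact absurd hle (not_le.mpr (mul_pos ha' h))
    obtain ⟨c, hc, hfc⟩ := intermediate_value_Icc' hab hf ⟨hb'.le, ha'.le⟩
    exact hne c hc hfc

/-- If a continuous real `f` on `[a, b]` vanishes at `a` with a non-zero derivative `r` there and
has no zeros on `(a, b]`, then `r·f(b) > 0` — the manuscript's
"`M(ρ+β₁)/(iM′(ρ)) = lim_{v→0⁺} vM(ρ+β₁)/M(ρ+iv) ≥ 0`" step (p. 12), via the right-hand slope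
of `f` at `a`. [cite: Zhang2022LandauSiegel, §2 proof of Lemma 2.3 p. 12] -/
theorem mul_pos_of_hasDerivAt_of_ne_zero {f : ℝ → ℝ} {a b r : ℝ} (hab : a < b)
    (hf : ContinuousOn f (Icc a b)) (hne : ∀ u ∈ Ioc a b, f u ≠ 0) (h0 : f a = 0)
    (hd : HasDerivAt f r a) (hr : r ≠ 0) : 0 < r * f b := by
  -- `g = r·f` has `g(a) = 0`, `g′(a) = r² > 0`
  have hg : HasDerivAt (fun u => r * f u) (r * r) a := hd.const_mul r
  have hslope : Tendsto (fun t : ℝ => t⁻¹ • (r * f (a + t) - r * f a)) (𝓝[>] 0) (𝓝 (r * r)) :=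
    hg.tendsto_slope_zero_right
  have hrr : 0 < r * r := mul_self_pos.mpr hr
  have hev : ∀ᶠ t : ℝ in 𝓝[>] 0, 0 < t⁻¹ • (r * f (a + t) - r * f a) :=
    hslope.eventually (lt_mem_nhds hrr)
  have hev' : ∀ᶠ t : ℝ in 𝓝[>] 0, 0 < t ∧ t < b - a := by
    have h1 : ∀ᶠ t : ℝ in 𝓝[>] 0, 0 < t := self_mem_nhdsWithin
    have h2 : ∀ᶠ t : ℝ in 𝓝[>] 0, t < b - a :=
      mem_nhdsWithin_of_mem_nhds (Iio_mem_nhds (by linarith))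
    exact h1.and h2
  obtain ⟨t, ht, ht0, htb⟩ := (hev.and hev').exists
  -- so `g(a + t) > 0` for some small `t > 0`
  have hgt : 0 < r * f (a + t) := by
    rw [h0, mul_zero, sub_zero, smul_eq_mul] at ht
    have := mul_pos ht0 ht
    rwa [← mul_assoc, mul_inv_cancel₀ ht0.ne', one_mul] at this
  -- and `g` keeps its sign on `[a + t, b]`
  have hcont : ContinuousOn (fun u => r * f u) (Icc (a + t) b) :=
    (continuousOn_const.mul hf).mono (Icc_subset_Icc (by linarith) le_rfl)
  have hne' : ∀ u ∈ Icc (a + t) b, r * f u ≠ 0 := fun u hu =>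
    mul_ne_zero hr (hne u ⟨by linarith [hu.1], hu.2⟩)
  have hprod := mul_pos_of_continuousOn_of_ne_zero (by linarith) hcont hne'
  by_contra hle
  push Not at hle
  nlinarith [hprod, hgt, hle]

/-! ## Consecutive zeros: where the restated gap assertion (iii) puts the zeros above `ρ` -/

/-- In a finite set of points of `ℂ`, above any point `s` that is not the highest there is a LOWEST
point `s₊` with `Im s₊ > Im s` — the zero "consecutive" to `s` of Proposition 2.2 (iii).
[cite: Zhang2022LandauSiegel, §2 Prop. 2.2 (iii) p. 7] -/
theorem exists_next_above {S : Set ℂ} (hS : S.Finite) {s z : ℂ} (hz : z ∈ S) (hsz : s.im < z.im) :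
    ∃ w ∈ S, s.im < w.im ∧ ∀ u ∈ S, s.im < u.im → w.im ≤ u.im := by
  obtain ⟨w, hw, hmin⟩ := Set.exists_min_image {u ∈ S | s.im < u.im} Complex.im
    (hS.subset (Set.sep_subset _ _)) ⟨z, hz, hsz⟩
  exact ⟨w, hw.1, hw.2, fun u hu hsu => hmin u ⟨hu, hsu⟩⟩

/-- **The restated gap assertion, one step up** (p. 7: "`|γ′ − γ − α| < c′α²𝓛`" for consecutive
zeros): if `S` is finite and every consecutive pair of its points (ordered by height) has height
difference within `e` of `a`, then above any non-top point `s ∈ S` the next point `s₊` has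
`Im s + a − e < Im s₊ < Im s + a + e`, and every point above `s` is at least as high as `s₊`.
[cite: Zhang2022LandauSiegel, §2 Prop. 2.2 (iii) p. 7] -/
theorem exists_next_above_gap {S : Set ℂ} (hS : S.Finite) {a e : ℝ}
    (hgap : ∀ s ∈ S, ∀ s' ∈ S, s.im < s'.im →
      (∀ s'' ∈ S, ¬ (s.im < s''.im ∧ s''.im < s'.im)) → |s'.im - s.im - a| < e)
    {s z : ℂ} (hs : s ∈ S) (hz : z ∈ S) (hsz : s.im < z.im) :
    ∃ w ∈ S, s.im + a - e < w.im ∧ w.im < s.im + a + e ∧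
      ∀ u ∈ S, s.im < u.im → w.im ≤ u.im := by
  obtain ⟨w, hw, hlt, hmin⟩ := exists_next_above hS hz hsz
  have h := hgap s hs w hw hlt (fun u hu hu' => (not_le.mpr hu'.2) (hmin u hu hu'.1))
  rw [abs_lt] at h
  exact ⟨w, hw, by linarith [h.1], by linarith [h.2], hmin⟩

/-- **"`M(ρ+iv,ψ) ≠ 0` if `0 < v ≤ |β₁|`"**, the zero-location half (p. 11): under the gap
hypothesis every point of `S` above `s ∈ S` is higher than `Im s + a − e` (so there is none at
height `≤ Im s + α(1 − 5c′α𝓛) ≤ Im s + α − c′α²𝓛`). [cite: Zhang2022LandauSiegel, §2 proof of Lemma 2.3 p. 11] -/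
theorem im_gt_of_gap {S : Set ℂ} (hS : S.Finite) {a e : ℝ}
    (hgap : ∀ s ∈ S, ∀ s' ∈ S, s.im < s'.im →
      (∀ s'' ∈ S, ¬ (s.im < s''.im ∧ s''.im < s'.im)) → |s'.im - s.im - a| < e)
    {s z : ℂ} (hs : s ∈ S) (hz : z ∈ S) (hsz : s.im < z.im) : s.im + a - e < z.im := by
  obtain ⟨w, -, h1, -, hmin⟩ := exists_next_above_gap hS hgap hs hz hsz
  exact lt_of_lt_of_le h1 (hmin z hz hsz)

/-- **"`M(ρ+iv,ψ) ≠ 0` if `|β₂| ≤ v ≤ |β₃|`"**, the zero-location half (p. 11): under the gap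
hypothesis (with `a + e > 0`) no point of `S` has height in `[Im s + 2a + 2e, Im s + 3a − 3e]`
for `s ∈ S` — the next three zeros above `s` sit in `(Im s + ka − ke, Im s + ka + ke)`, `k = 1,2,3`
(`|β₂| = 2α + 2c′α²𝓛`, `|β₃| = 3α − 3c′α²𝓛`). [cite: Zhang2022LandauSiegel, §2 proof of Lemma 2.3 p. 11] -/
theorem im_gt_of_gap_three {S : Set ℂ} (hS : S.Finite) {a e : ℝ} (hae : 0 < a + e)
    (hgap : ∀ s ∈ S, ∀ s' ∈ S, s.im < s'.im →
      (∀ s'' ∈ S, ¬ (s.im < s''.im ∧ s''.im < s'.im)) → |s'.im - s.im - a| < e)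
    {s z : ℂ} (hs : s ∈ S) (hz : z ∈ S) (h2 : s.im + 2 * a + 2 * e ≤ z.im) :
    s.im + 3 * a - 3 * e < z.im := by
  obtain ⟨s₁, hs₁, h1l, h1u, -⟩ := exists_next_above_gap hS hgap hs hz (by linarith)
  obtain ⟨s₂, hs₂, h2l, h2u, -⟩ := exists_next_above_gap hS hgap hs₁ hz (by linarith)
  obtain ⟨s₃, -, h3l, -, hmin₃⟩ := exists_next_above_gap hS hgap hs₂ hz (by linarith)
  have h3 := hmin₃ z hz (by linarith)
  linarith

/-! ## The zeros of `L(s,ψ)L(s,ψχ)` in `Ω` form a finite set -/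

section Setting

variable {D : ℕ} [NeZero D] (χ : DirichletCharacter ℂ D)

/-- `ψχ (mod Dp)` is non-principal for `D ≥ 3`, `χ` primitive (it is primitive to the modulus
`Dp ≠ 1`, `psiChiPrimitive_holds`). [cite: Zhang2022LandauSiegel, §4 p. 8] -/
theorem psiChi_ne_one (hD : 3 ≤ D) (hχ : χ.IsPrimitive) (x : Chr D) : psiChi χ x ≠ 1 :=
  GammaFactor.ne_one_of_isPrimitive (psiChiPrimitive_holds D χ x hD hχ)
    (fun h => by have := Nat.eq_one_of_mul_eq_one_right h; omega)

/-- `s ↦ L(s,ψ)L(s,ψχ)` is entire (`ψ`, `ψχ` non-principal). [cite: Zhang2022LandauSiegel, §2 Prop. 2.2] -/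
theorem differentiable_LL (hD : 3 ≤ D) (hχ : χ.IsPrimitive) (x : Chr D) :
    Differentiable ℂ (fun s => x.ψ.LFunction s * (psiChi χ x).LFunction s) :=
  (DirichletCharacter.differentiable_LFunction x.ψ_ne_one).mul
    (DirichletCharacter.differentiable_LFunction (psiChi_ne_one χ hD hχ x))

/-- **The zeros of `L(s,ψ)L(s,ψχ)` in `Ω` form a finite set** (`D ≥ 3`, `χ` primitive): the entire
function `L(s,ψ)L(s,ψχ)` does not vanish at `s = 2`, so its zeros cannot accumulate in the bounded
region `Ω` (identity principle) — which is what makes "consecutive zeros" (Prop. 2.2 (iii))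
meaningful. [cite: Zhang2022LandauSiegel, §2 Prop. 2.2 (iii)] -/
theorem prodZeroSetOmega_finite (hD : 3 ≤ D) (hχ : χ.IsPrimitive) (x : Chr D) :
    (prodZeroSetOmega χ x).Finite := by
  by_contra hinf
  have hsub : prodZeroSetOmega χ x ⊆ Metric.closedBall (s0 D) (1 / 2 + (ell1 D + 2)) := by
    intro s hs
    obtain ⟨⟨hre, him⟩, -⟩ := hs
    rw [Metric.mem_closedBall, dist_eq_norm]
    have h := Complex.norm_le_abs_re_add_abs_im (s - s0 D)
    linarith [le_of_lt hre, le_of_lt him]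
  obtain ⟨z₀, -, hacc⟩ :=
    Set.Infinite.exists_accPt_of_subset_isCompact hinf (isCompact_closedBall _ _) hsub
  have hfreq : ∃ᶠ z in 𝓝[≠] z₀, x.ψ.LFunction z * (psiChi χ x).LFunction z = 0 :=
    (accPt_iff_frequently_nhdsNE.mp hacc).mono fun z hz => hz.2
  have hanal : AnalyticOnNhd ℂ (fun s => x.ψ.LFunction s * (psiChi χ x).LFunction s) Set.univ :=
    Complex.analyticOnNhd_univ_iff_differentiable.mpr (differentiable_LL χ hD hχ x)
  have hzero := hanal.eqOn_zero_of_preconnected_of_frequently_eq_zero isPreconnected_univ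
    (Set.mem_univ z₀) hfreq
  have h2 : x.ψ.LFunction 2 * (psiChi χ x).LFunction 2 ≠ 0 :=
    mul_ne_zero
      (DirichletCharacter.LFunction_ne_zero_of_one_le_re x.ψ (Or.inl x.ψ_ne_one) (by norm_num))
      (DirichletCharacter.LFunction_ne_zero_of_one_le_re _ (Or.inl (psiChi_ne_one χ hD hχ x))
        (by norm_num))
  exact h2 (hzero (Set.mem_univ (2 : ℂ)))

/-! ## `M(½+iu,ψ)` as a real continuous function of `u`, its zeros and its derivative -/

omit [NeZero D] in
/-- `Re(½ + iu) = ½`. [folklore] -/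
private theorem re_half_add_mul_I (u : ℝ) : ((1 : ℂ) / 2 + u * I).re = 1 / 2 := by simp

omit [NeZero D] in
/-- `Im(½ + iu) = u`. [folklore] -/
private theorem im_half_add_mul_I (u : ℝ) : ((1 : ℂ) / 2 + u * I).im = u := by simp

omit [NeZero D] in
/-- **(2.11)** for the skeleton's `M = Mfun x.ψ` (`Y = Yroot x.ψ`): `M(½+iu,ψ)` is real for `u > 0`
(tree `GammaFactor.M_half_im_eq_zero`). [cite: Zhang2022LandauSiegel, §2 (2.11)] -/
theorem Mfun_half_im_eq_zero (x : Chr D) {u : ℝ} (hu : 0 < u) :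
    (Mfun x.ψ ((1 : ℂ) / 2 + u * I)).im = 0 :=
  GammaFactor.M_half_im_eq_zero x.prim x.p_ne_one hu
    ((Yroot_spec x.prim).2 _ (by rw [im_half_add_mul_I]; exact hu))

omit [NeZero D] in
/-- So `M(½+iu,ψ)` is the real number `Re M(½+iu,ψ)`, `u > 0`. [cite: Zhang2022LandauSiegel, §2 (2.11)] -/
theorem Mfun_half_eq_ofReal (x : Chr D) {u : ℝ} (hu : 0 < u) :
    Mfun x.ψ ((1 : ℂ) / 2 + u * I) = ((Mfun x.ψ ((1 : ℂ) / 2 + u * I)).re : ℂ) :=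
  Complex.ext (by simp) (by rw [Mfun_half_im_eq_zero x hu, Complex.ofReal_im])

omit [NeZero D] in
/-- `M(·,ψ) = Y·L(·,ψ)` is holomorphic on the upper half-plane. [cite: Zhang2022LandauSiegel, §2 p. 5] -/
theorem differentiableOn_Mfun (x : Chr D) : DifferentiableOn ℂ (Mfun x.ψ) {s : ℂ | 0 < s.im} :=
  (Yroot_spec x.prim).1.mul
    (DirichletCharacter.differentiable_LFunction x.ψ_ne_one).differentiableOn

omit [NeZero D] in
/-- "`M(1/2+it,ψ)` is a real-valued continuous function in `t`" (p. 11): `u ↦ Re M(½+iu,ψ)` is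
continuous on `[a, b]` for `a > 0`. [cite: Zhang2022LandauSiegel, §2 proof of Lemma 2.3 p. 11] -/
theorem continuousOn_Mfun_half_re (x : Chr D) {a b : ℝ} (ha : 0 < a) :
    ContinuousOn (fun u : ℝ => (Mfun x.ψ ((1 : ℂ) / 2 + u * I)).re) (Icc a b) := by
  have hpath : Continuous fun u : ℝ => (1 : ℂ) / 2 + u * I := by fun_prop
  have hmaps : MapsTo (fun u : ℝ => (1 : ℂ) / 2 + u * I) (Icc a b) {s : ℂ | 0 < s.im} := by
    intro u hu
    simp only [Set.mem_setOf_eq, im_half_add_mul_I]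
    exact lt_of_lt_of_le ha hu.1
  exact Complex.continuous_re.comp_continuousOn
    ((differentiableOn_Mfun x).continuousOn.comp hpath.continuousOn hmaps)

omit [NeZero D] in
/-- `M(s,ψ) ≠ 0` wherever `L(s,ψ) ≠ 0` on the upper half-plane (`Y(s)² = Z(s,ψ)⁻¹ ≠ 0`).
[cite: Zhang2022LandauSiegel, §2 p. 5] -/
theorem Mfun_ne_zero (x : Chr D) {s : ℂ} (hs : 0 < s.im) (hL : x.ψ.LFunction s ≠ 0) :
    Mfun x.ψ s ≠ 0 := by
  refine mul_ne_zero (fun h0 => ?_) hL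
  have h := (Yroot_spec x.prim).2 s hs
  rw [h0, zero_pow two_ne_zero] at h
  exact inv_ne_zero (GammaFactor.Zfac_ne_zero x.prim hs) h.symm

omit [NeZero D] in
/-- **(2.12)**: the real function `u ↦ Re M(½+iu,ψ)` has derivative `Re(iM′(½+iu,ψ))` at `u > 0`,
and `iM′(½+iu,ψ)` is real (tree `GammaFactor.I_mul_deriv_M_half_im_eq_zero`).
[cite: Zhang2022LandauSiegel, §2 (2.12)] -/
theorem hasDerivAt_Mfun_half_re (x : Chr D) {u : ℝ} (hu : 0 < u) :
    HasDerivAt (fun v : ℝ => (Mfun x.ψ ((1 : ℂ) / 2 + v * I)).re)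
      (I * deriv (Mfun x.ψ) ((1 : ℂ) / 2 + u * I)).re u ∧
    (I * deriv (Mfun x.ψ) ((1 : ℂ) / 2 + u * I)).im = 0 := by
  have hUo : IsOpen {s : ℂ | 0 < s.im} := isOpen_lt continuous_const Complex.continuous_im
  have hMd : DifferentiableAt ℂ (Mfun x.ψ) ((1 : ℂ) / 2 + u * I) :=
    (differentiableOn_Mfun x).differentiableAt (hUo.mem_nhds (by simpa using hu))
  have haff : HasDerivAt (fun v : ℝ => (1 : ℂ) / 2 + v * I) I u := by
    simpa using ((hasDerivAt_id u).ofReal_comp.mul_const I).const_add ((1 : ℂ) / 2)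
  have hcomp := hMd.hasDerivAt.comp u haff
  have hre : HasDerivAt (⇑Complex.reCLM ∘ (Mfun x.ψ ∘ fun v : ℝ => (1 : ℂ) / 2 + v * I))
      (Complex.reCLM (deriv (Mfun x.ψ) ((1 : ℂ) / 2 + u * I) * I)) u :=
    Complex.reCLM.hasFDerivAt.comp_hasDerivAt u hcomp
  refine ⟨?_, GammaFactor.I_mul_deriv_M_half_im_eq_zero x.prim x.p_ne_one (Yroot_spec x.prim).1
    (Yroot_spec x.prim).2 hu⟩
  rw [Complex.reCLM_apply, mul_comm] at hre
  exact hre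

/-! ## The zero-free ranges above `ρ ∈ 𝔷(ψ)` from Proposition 2.2 (i), (iii) -/

omit [NeZero D] in
/-- For `ρ ∈ 𝔷(ψ)` and `Im ρ ≤ u < Im ρ + 2`, the point `½ + iu` lies in `Ω` ("(2.14) is slightly
smaller than `Ω`"). [cite: Zhang2022LandauSiegel, §2 (2.14)] -/
theorem half_add_mem_Omega {x : Chr D} {ρ : ℂ} (hρ : ρ ∈ zeroSet D x) {u : ℝ} (h1 : ρ.im ≤ u)
    (h2 : u < ρ.im + 2) : (1 : ℂ) / 2 + u * I ∈ Omega D := by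
  obtain ⟨-, him, -⟩ := hρ
  refine ⟨?_, ?_⟩
  · rw [Complex.sub_re, s0_re, re_half_add_mul_I, sub_self, abs_zero]; norm_num
  · rw [Complex.sub_im, s0_im, im_half_add_mul_I]
    rw [abs_lt] at him ⊢
    constructor <;> linarith [him.1, him.2]

/-- **"By (2.) we see that `M(ρ+iv,ψ) ≠ 0` if `|β₂| ≤ v ≤ |β₃|`" and "… if `0 < v ≤ |β₁|`"**
(p. 11), for `L(s,ψ)`: if the zeros of `L(s,ψ)L(s,ψχ)` in `Ω` form a finite set `S ∋ ρ` whose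
consecutive heights differ by `a ± e` (`a + e > 0`; Prop. 2.2 (iii) restated: `a = α`,
`e = c′α²𝓛`), then `L(½+iu,ψ) ≠ 0` for `Im ρ < u ≤ Im ρ + a − e` and for
`Im ρ + 2a + 2e ≤ u ≤ Im ρ + 3a − 3e`, as long as `½ + iu ∈ Ω`.
[cite: Zhang2022LandauSiegel, §2 proof of Lemma 2.3 p. 11] -/
theorem LFunction_half_ne_zero_of_gap {x : Chr D} (hfin : (prodZeroSetOmega χ x).Finite)
    {a e : ℝ} (hae : 0 < a + e)
    (hgap : ∀ s ∈ prodZeroSetOmega χ x, ∀ s' ∈ prodZeroSetOmega χ x, s.im < s'.im →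
      (∀ s'' ∈ prodZeroSetOmega χ x, ¬ (s.im < s''.im ∧ s''.im < s'.im)) →
        |s'.im - s.im - a| < e)
    {ρ : ℂ} (hρS : ρ ∈ prodZeroSetOmega χ x) {u : ℝ} (hΩ : (1 : ℂ) / 2 + u * I ∈ Omega D)
    (hu : (ρ.im < u ∧ u ≤ ρ.im + a - e) ∨ (ρ.im + 2 * a + 2 * e ≤ u ∧ u ≤ ρ.im + 3 * a - 3 * e)) :
    x.ψ.LFunction ((1 : ℂ) / 2 + u * I) ≠ 0 := by
  intro h0
  have hz : (1 : ℂ) / 2 + u * I ∈ prodZeroSetOmega χ x := ⟨hΩ, by rw [h0, zero_mul]⟩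
  rcases hu with ⟨h1, h2⟩ | ⟨h1, h2⟩
  · have h := im_gt_of_gap hfin hgap hρS hz (by rw [im_half_add_mul_I]; exact h1)
    rw [im_half_add_mul_I] at h
    linarith
  · have h := im_gt_of_gap_three hfin hae hgap hρS hz (by rw [im_half_add_mul_I]; exact h1)
    rw [im_half_add_mul_I] at h
    linarith

/-! ## The proof of Lemma 2.3 at one zero `ρ ∈ 𝔷(ψ)` -/

/-- **Simplicity gives `L′(ρ,ψ) ≠ 0`** (p. 5 "Note that `M′(ρ,ψ) = Y(ρ,ψ)L′(ρ,ψ) ≠ 0`", via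
Prop. 2.2 (ii)): at a zero `ρ` of `L(s,ψ)`, `(L(·,ψ)L(·,ψχ))′(ρ) = L′(ρ,ψ)L(ρ,ψχ)`, so
`(LL)′(ρ) ≠ 0` forces `L′(ρ,ψ) ≠ 0`. [cite: Zhang2022LandauSiegel, §2 p. 5] -/
theorem deriv_LFunction_ne_zero_of_deriv_LL_ne_zero (hD : 3 ≤ D) (hχ : χ.IsPrimitive) (x : Chr D)
    {ρ : ℂ} (hL0 : x.ψ.LFunction ρ = 0)
    (hLL : deriv (fun w => x.ψ.LFunction w * (psiChi χ x).LFunction w) ρ ≠ 0) :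
    deriv x.ψ.LFunction ρ ≠ 0 := by
  intro h1
  apply hLL
  have hA : HasDerivAt x.ψ.LFunction (deriv x.ψ.LFunction ρ) ρ :=
    ((DirichletCharacter.differentiable_LFunction x.ψ_ne_one) ρ).hasDerivAt
  have hB : HasDerivAt (psiChi χ x).LFunction (deriv (psiChi χ x).LFunction ρ) ρ :=
    ((DirichletCharacter.differentiable_LFunction (psiChi_ne_one χ hD hχ x)) ρ).hasDerivAt
  change deriv (x.ψ.LFunction * (psiChi χ x).LFunction) ρ = 0
  rw [(hA.mul hB).deriv, hL0, h1, zero_mul, zero_mul, add_zero]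

end Setting

end Literature.NumberTheory.LFunctions.Zhang2022.Skeleton
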